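import Literature.NumberTheory.Automorphic.HeckeAlgebra
import Literature.NumberTheory.Automorphic.CosetIntegral
import HarnessLib

/-!
# Proofs for `HeckeAlgebra`: Hecke operators as convolution integrals
(`heckeOperator_apply_eq_integral`) and Frobenius reciprocity `ℋ(G, K) ≅ C_c(K\G/K; k)`
(`nonempty_linearEquiv_biInvariant`)

This file proves the named fact `Literature.NumberTheory.Automorphic.heckeOperator_apply_eq_integral`
of `Literature/NumberTheory/Automorphic/HeckeAlgebra.lean`: for a compact open subgroup `K` of a
topological group `G` with left Haar measure `μ`, a representation `ρ` of `G` on a complex Banach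
space `V` and a `K`-fixed vector `v`,

  `[KgK] v = ∑_{yK ⊆ KgK} ρ(y) v = μ(K)⁻¹ ∫_{KgK} ρ(z) v dμ(z)`,

i.e. the Hecke operator of the double coset `KgK` is `π(𝟙_{KgK}) / μ(K)` on `V^K`
(Cartier 1979, §IV.1 — the action `π(f) v = ∫_G f(g) π(g) v dg` of the Hecke algebra
`ℋ(G, K) = C_c(K\G/K)` on `V^K`, with `KgK = ⋃ᵢ gᵢK` a finite disjoint union and `z ↦ ρ(z) v`
constant on each `gᵢK`; Bushnell–Henniart 2006, §4.1–4.2).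

## Proof

`K` compact open makes `(G, K)` a Hecke pair (`isHeckeTriple_top_of_isCompact_isOpen`), so the
`K`-orbit `T` of `gK` in `G ⧸ K` is finite (`finite_orbit_quotient`) and
`heckeOperator ρ K g v = ∑_{γ ∈ T} ρ(γ.out) v`. The double coset `KgK` is the (finite, disjoint)
union over `γ ∈ T` of the fibres `{x | xK = γ}` of `G → G ⧸ K`
(`doubleCoset_eq_biUnion_setOf_mk_eq`), each open of measure `μ(K)`, and the integrand
`z ↦ ρ(z) v` is right-`K`-invariant, hence constant `= ρ(γ.out) v` on the fibre over `γ`; so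
`∫_{KgK} ρ(z) v dμ = ∑_{γ ∈ T} μ(K) • ρ(γ.out) v` (`setIntegral_setOf_mk_eq` of
`CosetIntegral`, `MeasureTheory.integral_biUnion_finset`), and `0 < μ(K) < ∞` (open, compact)
cancels the normalisation.

## Frobenius reciprocity (second part of the file)

The section `BiInvariantEquiv` discharges the named fact
`Literature.NumberTheory.Automorphic.nonempty_linearEquiv_biInvariant`: for a Hecke pair `(G, K)`
(`[IsHeckeTriple ⊤ K K]`) and any commutative ring `k`, the Hecke algebra
`heckeAlgebra k G K = End_G(k[G ⧸ K])` is `k`-linearly isomorphic to `biInvariantFunctions k G K`,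
the bi-`K`-invariant functions `G → k` meeting finitely many double cosets. The isomorphism is the
explicit `heckeAlgebraEquivBiInvariant`: `T ↦ (g ↦ coefficient of [gK] in T [K])`, with inverse
`f ↦ heckeAlgebra.extend K w_f = ([gK] ↦ ρ(g) w_f)`, `w_f = ∑_{gK} f(g) [gK] ∈ k[G ⧸ K]^K`
(finitely supported because every double coset of a Hecke pair is a finite union of left cosets,
`finite_orbit_quotient`), built on the reciprocity API `heckeAlgebra.extend`,
`heckeAlgebra.doubleCosetCoeff` of `HeckeAlgebra` and compatible with its double-coset coordinates
(`doubleCosetCoeff_apply_mk`). This is the Frobenius-reciprocity identification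
`End_G(c-Ind_K^G 𝟙) = (c-Ind_K^G 𝟙)^K = C_c(K\G/K)` (Cartier 1979, §I.3–I.4; Bushnell–Henniart
2006, §4.1), over a general commutative ring and for an abstract Hecke pair; no topology or
measure is involved in this part.

## References

* P. Cartier, *Representations of p-adic groups: a survey*, Proc. Sympos. Pure Math. 33 (1979),
  part 1, 111–155, §I.3–I.4 and §IV.1 [Cartier1979].
* C. Bushnell, G. Henniart, *The local Langlands conjecture for GL(2)*, Springer 2006, §4.1–4.2.
-/

open MeasureTheory
open scoped Pointwise

namespace Literature.NumberTheory.Automorphic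

section Haar

variable {G : Type*} [Group G]

/-- The double coset `KgK` is the union, over the `K`-orbit of `gK` in `G ⧸ K`, of the fibres of
`G → G ⧸ K`: `z ∈ KgK ↔ zK ∈ K · gK` (Shimura, Proposition 3.1; Bushnell–Henniart §4.1). [folklore] -/
theorem doubleCoset_eq_biUnion_setOf_mk_eq (K : Subgroup G) (g : G) :
    DoubleCoset.doubleCoset g (K : Set G) K =
      ⋃ γ ∈ MulAction.orbit K (g : G ⧸ K), {x : G | (x : G ⧸ K) = γ} := by
  ext z
  simp only [DoubleCoset.mem_doubleCoset, SetLike.mem_coe, Set.mem_iUnion, Set.mem_setOf_eq,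
    exists_prop, exists_eq_right', MulAction.mem_orbit_iff]
  constructor
  · rintro ⟨x, hx, y, hy, rfl⟩
    refine ⟨⟨x, hx⟩, ?_⟩
    change (((x : G) * g : G) : G ⧸ K) = _
    rw [QuotientGroup.eq, inv_mul_cancel_left]
    exact hy
  · rintro ⟨⟨x, hx⟩, hxz⟩
    change (((x : G) * g : G) : G ⧸ K) = _ at hxz
    rw [QuotientGroup.eq] at hxz
    exact ⟨x, hx, (x * g)⁻¹ * z, hxz, (mul_inv_cancel_left (x * g) z).symm⟩

variable [TopologicalSpace G] [IsTopologicalGroup G] [MeasurableSpace G]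
  [BorelSpace G] (μ : Measure G) [μ.IsHaarMeasure] (K : Subgroup G)
  {V : Type*} [NormedAddCommGroup V] [NormedSpace ℂ V] [CompleteSpace V]

/-- **Haar/convolution description of Hecke operators** (discharge of the named fact
`heckeOperator_apply_eq_integral`). For `K` compact open in a topological group `G` with left Haar
measure `μ`, a representation `ρ` of `G` on a complex Banach space `V`, `g ∈ G` and `v ∈ V^K`,
`heckeOperator ρ K g v = μ(K)⁻¹ • ∫_{KgK} ρ(z) v dμ(z)`, i.e. `[KgK]` acts on `V^K` as
`π(𝟙_{KgK}) / μ(K)` where `π(f) v = ∫_G f(z) ρ(z) v dμ(z)` (Cartier 1979, §IV.1;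
Bushnell–Henniart 2006, §4.1–4.2). Proof: `KgK = ⨆_{γ ∈ K·gK} γ` is a finite disjoint union of
left cosets, each open of measure `μ(K)`, on which `z ↦ ρ(z) v` is constant.
[cite: Cartier1979, §IV.1] -/
theorem heckeOperator_apply_eq_integral_holds :
    heckeOperator_apply_eq_integral (V := V) μ K := by
  intro hK hK' ρ g v hv
  classical
  haveI : IsHeckeTriple (⊤ : Submonoid G) K K := isHeckeTriple_top_of_isCompact_isOpen K hK hK'
  have hfin : (MulAction.orbit K (g : G ⧸ K)).Finite := finite_orbit_quotient K g
  -- the integrand is right-`K`-invariant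
  have hF : ∀ x : G, ∀ k ∈ K, ρ (x * k) v = ρ x v := fun x k hk => by
    rw [map_mul, Module.End.mul_apply, (ρ.mem_fixedPoints K v).1 hv k hk]
  have hμK : μ K < ⊤ := hK.measure_lt_top
  have hne : (μ K).toReal ≠ 0 :=
    ENNReal.toReal_ne_zero.2 ⟨hK'.measure_ne_zero μ ⟨1, K.one_mem⟩, hμK.ne⟩
  have hset : DoubleCoset.doubleCoset g (K : Set G) K =
      ⋃ γ ∈ hfin.toFinset, {x : G | (x : G ⧸ K) = γ} := by
    rw [doubleCoset_eq_biUnion_setOf_mk_eq]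
    simp only [Set.Finite.mem_toFinset]
  have key := fun γ : G ⧸ K =>
    setIntegral_setOf_mk_eq (μ := μ) (F := fun z => ρ z v) hK' hμK hF γ
  rw [heckeOperator, finsum_mem_eq_finite_toFinset_sum _ hfin, LinearMap.sum_apply, hset,
    integral_biUnion_finset _ (fun γ _ => measurableSet_setOf_mk_eq hK' γ)
      (fun γ _ γ' _ h => disjoint_setOf_mk_eq K h) (fun γ _ => (key γ).1),
    Finset.sum_congr rfl fun γ _ => (key γ).2, ← Finset.smul_sum, inv_smul_smul₀ hne]

end Haar

/-! ### Frobenius reciprocity: `ℋ(G, K) ≅ C_c(K\G/K; k)` (discharge of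
`nonempty_linearEquiv_biInvariant`)

For `T ∈ ℋ(G, K) = End_G(k[G ⧸ K])` the vector `T [K]` is `K`-fixed
(`heckeAlgebra.ofMulAction_apply_single_one`), and `T ↦ (g ↦ coefficient of [gK] in T [K])`
identifies `ℋ(G, K)` with the bi-`K`-invariant functions `G → k` meeting finitely many double
cosets; the inverse sends `f` to the `G`-endomorphism `heckeAlgebra.extend K w_f : [gK] ↦ ρ(g) w_f`
of `HeckeAlgebra`, where `w_f = ∑_{gK} f(g) [gK] ∈ k[G ⧸ K]^K` is finitely supported because
every double coset of a Hecke pair is a finite union of left cosets (`finite_orbit_quotient`).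
This is the Frobenius-reciprocity description `End_G(c-Ind_K^G 𝟙) = (c-Ind_K^G 𝟙)^K = C_c(K\G/K)`
(Cartier 1979, §I.3–I.4; Bushnell–Henniart 2006, §4.1); `doubleCosetCoeff_apply_mk` records its
compatibility with the double-coset coordinates `heckeAlgebra.doubleCosetCoeff` of
`HeckeAlgebra`. -/

section BiInvariantEquiv

open Representation

variable {k G : Type*} [CommRing k] [Group G] {K : Subgroup G}

/-- `(xg)K = x • gK` in `G ⧸ K`. [folklore] -/
private lemma coe_mul_eq_smul_coe (x g : G) : ((x * g : G) : G ⧸ K) = x • (g : G ⧸ K) := rfl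

/-- The double coset of the chosen representative of `gK` is `KgK`. [folklore] -/
private lemma doubleCoset_mk_out_coe (g : G) :
    DoubleCoset.mk K K ((g : G ⧸ K).out) = DoubleCoset.mk K K g := by
  obtain ⟨h, H⟩ := QuotientGroup.mk_out_eq_mul K g
  rw [H, eq_comm, DoubleCoset.eq]
  exact ⟨1, K.one_mem, h, h.2, by rw [one_mul]⟩

/-- If `w ∈ k[G ⧸ K]` is fixed by `K`, then `ρ((gK).out) w = ρ(g) w` for the permutation
representation `ρ` of `G` on `k[G ⧸ K]`. [folklore] -/
private lemma ofMulAction_out_coe_apply {w : MonoidAlgebra k (G ⧸ K)}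
    (hw : ∀ y ∈ K, ofMulAction k G (G ⧸ K) y w = w) (g : G) :
    ofMulAction k G (G ⧸ K) (g : G ⧸ K).out w = ofMulAction k G (G ⧸ K) g w := by
  obtain ⟨h, H⟩ := QuotientGroup.mk_out_eq_mul K g
  rw [H, map_mul, Module.End.mul_apply, hw h h.2]

/-- A bi-`K`-invariant function takes the same value at `g` and at the chosen representative
of `gK`. [folklore] -/
private lemma apply_out_coe {β : Type*} {f : G → β}
    (hf : ∀ x ∈ K, ∀ y ∈ K, ∀ g : G, f (x * g * y) = f g) (g : G) : f (g : G ⧸ K).out = f g := by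
  obtain ⟨h, H⟩ := QuotientGroup.mk_out_eq_mul K g
  rw [H]
  simpa only [one_mul] using hf 1 K.one_mem h h.2 g

/-- A bi-`K`-invariant function, read on representatives of `G ⧸ K`, is `K`-invariant. [folklore] -/
private lemma apply_out_smul {β : Type*} {f : G → β}
    (hf : ∀ x ∈ K, ∀ y ∈ K, ∀ g : G, f (x * g * y) = f g) {x : G} (hx : x ∈ K) (q : G ⧸ K) :
    f (x • q).out = f q.out := by
  rw [← MulAction.Quotient.coe_smul_out, smul_eq_mul, apply_out_coe hf]
  simpa only [mul_one] using hf x hx 1 K.one_mem q.out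

/-- A finitely supported function on `G ⧸ K`, pulled back to `G`, meets only finitely many double
cosets. [folklore] -/
private lemma finite_image_mk_support_coeff (w : MonoidAlgebra k (G ⧸ K)) :
    (DoubleCoset.mk K K '' Function.support fun g : G => w.coeff (g : G ⧸ K)).Finite := by
  classical
  refine (w.coeff.support.image fun q : G ⧸ K => DoubleCoset.mk K K q.out).finite_toSet.subset ?_
  rintro _ ⟨g, hg, rfl⟩
  simp only [Finset.coe_image, Set.mem_image, Finset.mem_coe, Finsupp.mem_support_iff]
  exact ⟨(g : G ⧸ K), hg, doubleCoset_mk_out_coe g⟩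

variable (K) in
/-- For a Hecke pair, a function on `G` meeting finitely many double cosets, read on
representatives of `G ⧸ K`, is finitely supported: each `KgK/K` is finite
(`finite_orbit_quotient`; Shimura, Proposition 3.1). [folklore] -/
private lemma finite_support_apply_out [IsHeckeTriple (⊤ : Submonoid G) K K] (f : G → k)
    (hf : (DoubleCoset.mk K K '' Function.support f).Finite) :
    (Function.support fun q : G ⧸ K => f q.out).Finite := by
  refine (hf.biUnion (t := fun d => {q : G ⧸ K | DoubleCoset.mk K K q.out = d})
    fun d _ => ?_).subset fun q hq => ?_
  · obtain ⟨g₀, rfl⟩ : ∃ g₀, DoubleCoset.mk K K g₀ = d := ⟨_, DoubleCoset.out_eq' K K d⟩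
    refine (finite_orbit_quotient K g₀).subset
      fun q (hq : DoubleCoset.mk K K q.out = DoubleCoset.mk K K g₀) => ?_
    obtain ⟨x, hx, y, hy, hxy⟩ := (DoubleCoset.eq K K _ _).1 hq
    refine MulAction.mem_orbit_iff.2 ⟨⟨x⁻¹, K.inv_mem hx⟩, ?_⟩
    change ((x⁻¹ * g₀ : G) : G ⧸ K) = q
    rw [hxy, ← mul_assoc, ← mul_assoc, inv_mul_cancel, one_mul, QuotientGroup.mk_mul_of_mem _ hy,
      QuotientGroup.out_eq']
  · simp only [Set.mem_iUnion, Set.mem_setOf_eq, exists_prop]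
    exact ⟨_, ⟨q.out, hq, rfl⟩, rfl⟩

variable (k G K) in
/-- **Frobenius reciprocity, forward map** `ℋ(G, K) → C_c(K\G/K; k)`:
`T ↦ (g ↦ coefficient of [gK] in T [K])`; bi-`K`-invariance because `T [K]` is `K`-fixed, finitely
many double cosets because `T [K]` is finitely supported (Cartier 1979, §I.3–I.4;
Bushnell–Henniart 2006, §4.1). [cite: Cartier1979, §I.3] -/
noncomputable def heckeAlgebraToBiInvariant :
    heckeAlgebra k G K →ₗ[k] biInvariantFunctions k G K where
  toFun T :=
    ⟨fun g => ((T : Module.End k (MonoidAlgebra k (G ⧸ K)))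
        (MonoidAlgebra.single ((1 : G) : G ⧸ K) 1)).coeff (g : G ⧸ K), by
      refine ⟨fun x hx y hy g => ?_, finite_image_mk_support_coeff _⟩
      dsimp only
      rw [QuotientGroup.mk_mul_of_mem _ hy, coe_mul_eq_smul_coe]
      calc ((T : Module.End k (MonoidAlgebra k (G ⧸ K)))
              (MonoidAlgebra.single ((1 : G) : G ⧸ K) 1)).coeff (x • (g : G ⧸ K))
          = (ofMulAction k G (G ⧸ K) x⁻¹ ((T : Module.End k (MonoidAlgebra k (G ⧸ K)))
              (MonoidAlgebra.single ((1 : G) : G ⧸ K) 1))).coeff (g : G ⧸ K) := by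
            rw [coeff_ofMulAction, inv_inv]
        _ = ((T : Module.End k (MonoidAlgebra k (G ⧸ K)))
              (MonoidAlgebra.single ((1 : G) : G ⧸ K) 1)).coeff (g : G ⧸ K) := by
            rw [heckeAlgebra.ofMulAction_apply_single_one K T _ (K.inv_mem hx)]⟩
  map_add' S T := by
    ext g
    simp
  map_smul' c T := by
    ext g
    simp

/-- Unfolding lemma for `heckeAlgebraToBiInvariant`: its value at `g` is the coefficient of `[gK]`
in `T [K]`. [folklore] -/
@[simp] lemma heckeAlgebraToBiInvariant_apply (T : heckeAlgebra k G K) (g : G) :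
    (heckeAlgebraToBiInvariant k G K T : G → k) g =
      ((T : Module.End k (MonoidAlgebra k (G ⧸ K)))
        (MonoidAlgebra.single ((1 : G) : G ⧸ K) 1)).coeff (g : G ⧸ K) :=
  rfl

/-- **Compatibility of the two coordinate systems**: the double-coset coordinate
`heckeAlgebra.doubleCosetCoeff K T (KgK)` of `HeckeAlgebra` (coefficient of `T [K]` at a chosen
left coset in `KgK`) is the value at `g` of the bi-`K`-invariant function of `T` (coefficient at
`[gK]` itself): both are coefficients of the `K`-invariant vector `T [K]` along one `K`-orbit.
[folklore] -/
theorem doubleCosetCoeff_apply_mk (T : heckeAlgebra k G K) (g : G) :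
    heckeAlgebra.doubleCosetCoeff K T (HeckeCoset.mk K K ⟨g, Submonoid.mem_top g⟩) =
      (heckeAlgebraToBiInvariant k G K T : G → k) g := by
  rw [heckeAlgebra.doubleCosetCoeff_apply, heckeAlgebraToBiInvariant_apply,
    ← heckeAlgebra.toHeckeCoset_coe]
  exact heckeAlgebra.coeff_eq_of_mem_orbit K (heckeAlgebra.ofMulAction_apply_single_one K T)
    (heckeAlgebra.ofHeckeCoset_toHeckeCoset_mem_orbit K _)

/-- The element `w_f = ∑_{gK} f(g) [gK]` of `k[G ⧸ K]` attached to a function `f` on `G` that is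
finitely supported on representatives of `G ⧸ K`. [folklore] -/
private noncomputable def toMonoidAlgebra (f : G → k)
    (hf : (Function.support fun q : G ⧸ K => f q.out).Finite) : MonoidAlgebra k (G ⧸ K) :=
  .ofCoeff (Finsupp.ofSupportFinite _ hf)

/-- The coefficient of `[q]` in `w_f` is `f (q.out)`. [folklore] -/
@[simp] private lemma coeff_toMonoidAlgebra (f : G → k)
    (hf : (Function.support fun q : G ⧸ K => f q.out).Finite) (q : G ⧸ K) :
    (toMonoidAlgebra f hf).coeff q = f q.out :=
  rfl

/-- `w_f` is `K`-fixed when `f` is bi-`K`-invariant. [folklore] -/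
private lemma ofMulAction_toMonoidAlgebra {f : G → k}
    (hf : ∀ x ∈ K, ∀ y ∈ K, ∀ g : G, f (x * g * y) = f g)
    (hf' : (Function.support fun q : G ⧸ K => f q.out).Finite) {y : G} (hy : y ∈ K) :
    ofMulAction k G (G ⧸ K) y (toMonoidAlgebra f hf') = toMonoidAlgebra f hf' := by
  refine MonoidAlgebra.ext (Finsupp.ext fun q => ?_)
  rw [coeff_ofMulAction, coeff_toMonoidAlgebra, coeff_toMonoidAlgebra]
  exact apply_out_smul hf (K.inv_mem hy) q

variable [IsHeckeTriple (⊤ : Submonoid G) K K]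

variable (k G K) in
/-- **Frobenius reciprocity, inverse map** `C_c(K\G/K; k) → ℋ(G, K)`:
`f ↦ heckeAlgebra.extend K w_f = ([gK] ↦ ρ(g) w_f)` with `w_f = ∑_{gK} f(g) [gK] ∈ k[G ⧸ K]^K`,
finitely supported for a Hecke pair (Cartier 1979, §I.3–I.4; Bushnell–Henniart 2006, §4.1).
[cite: Cartier1979, §I.3] -/
noncomputable def biInvariantToHeckeAlgebra (f : biInvariantFunctions k G K) : heckeAlgebra k G K :=
  ⟨heckeAlgebra.extend K (toMonoidAlgebra (f : G → k) (finite_support_apply_out K _ f.2.2)),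
    heckeAlgebra.extend_mem K fun _ hy => ofMulAction_toMonoidAlgebra f.2.1 _ hy⟩

/-- `biInvariantToHeckeAlgebra` is a left inverse of `heckeAlgebraToBiInvariant`: a
`G`-endomorphism of `k[G ⧸ K]` is determined by the image of the generator `[K]`. [folklore] -/
private lemma biInvariantToHeckeAlgebra_heckeAlgebraToBiInvariant (T : heckeAlgebra k G K) :
    biInvariantToHeckeAlgebra k G K (heckeAlgebraToBiInvariant k G K T) = T := by
  apply Subtype.ext
  refine (MonoidAlgebra.basis (G ⧸ K) k).ext fun q => ?_
  have hw : toMonoidAlgebra _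
        (finite_support_apply_out K _ (heckeAlgebraToBiInvariant k G K T).2.2) =
      (T : Module.End k (MonoidAlgebra k (G ⧸ K))) (MonoidAlgebra.single ((1 : G) : G ⧸ K) 1) := by
    refine MonoidAlgebra.ext (Finsupp.ext fun q' => ?_)
    rw [coeff_toMonoidAlgebra, heckeAlgebraToBiInvariant_apply, QuotientGroup.out_eq']
  change heckeAlgebra.extend K _ (MonoidAlgebra.basis (G ⧸ K) k q) = _
  rw [MonoidAlgebra.basis_apply, heckeAlgebra.extend_single, one_smul, hw,
    ← heckeAlgebra.apply_ofMulAction_apply, ← heckeAlgebra.single_eq_ofMulAction_out]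

/-- `biInvariantToHeckeAlgebra` is a right inverse of `heckeAlgebraToBiInvariant`: the
coefficient of `[gK]` in `ρ(1) w_f = w_f` is `f g`. [folklore] -/
private lemma heckeAlgebraToBiInvariant_biInvariantToHeckeAlgebra
    (f : biInvariantFunctions k G K) :
    heckeAlgebraToBiInvariant k G K (biInvariantToHeckeAlgebra k G K f) = f := by
  apply Subtype.ext
  funext g
  rw [heckeAlgebraToBiInvariant_apply]
  change (heckeAlgebra.extend K (toMonoidAlgebra (f : G → k) (finite_support_apply_out K _ f.2.2))
    (MonoidAlgebra.single ((1 : G) : G ⧸ K) 1)).coeff (g : G ⧸ K) = (f : G → k) g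
  rw [heckeAlgebra.extend_single, one_smul,
    ofMulAction_out_coe_apply fun _ hy => ofMulAction_toMonoidAlgebra f.2.1 _ hy,
    map_one, Module.End.one_apply, coeff_toMonoidAlgebra, apply_out_coe f.2.1]

variable (k G K) in
/-- **Frobenius reciprocity**: the Hecke algebra `ℋ(G, K) = End_G(k[G ⧸ K])` of a Hecke pair is
`k`-linearly isomorphic to the bi-`K`-invariant functions `G → k` supported on finitely many
double cosets, via `T ↦ (g ↦ coefficient of [gK] in T [K])`, with inverse
`biInvariantToHeckeAlgebra` (Cartier 1979, §I.3–I.4, `ℋ(G, K) ≅ End_G(c-Ind_K^G 𝟙)`;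
Bushnell–Henniart 2006, §4.1). [cite: Cartier1979, §I.3] -/
noncomputable def heckeAlgebraEquivBiInvariant :
    heckeAlgebra k G K ≃ₗ[k] biInvariantFunctions k G K :=
  { heckeAlgebraToBiInvariant k G K with
    invFun := biInvariantToHeckeAlgebra k G K
    left_inv := biInvariantToHeckeAlgebra_heckeAlgebraToBiInvariant
    right_inv := heckeAlgebraToBiInvariant_biInvariantToHeckeAlgebra }

/-- `heckeAlgebraEquivBiInvariant` is `heckeAlgebraToBiInvariant` as a map. [folklore] -/
@[simp] lemma heckeAlgebraEquivBiInvariant_apply (T : heckeAlgebra k G K) :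
    heckeAlgebraEquivBiInvariant k G K T = heckeAlgebraToBiInvariant k G K T :=
  rfl

/-- The inverse of `heckeAlgebraEquivBiInvariant` is `biInvariantToHeckeAlgebra`. [folklore] -/
@[simp] lemma heckeAlgebraEquivBiInvariant_symm_apply (f : biInvariantFunctions k G K) :
    (heckeAlgebraEquivBiInvariant k G K).symm f = biInvariantToHeckeAlgebra k G K f :=
  rfl

variable (k G K) in
/-- Discharge of the named fact `nonempty_linearEquiv_biInvariant`: for a Hecke pair,
`ℋ(G, K) = End_G(k[G ⧸ K]) ≃ₗ[k] C_c(K\G/K; k)` by Frobenius reciprocity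
(`heckeAlgebraEquivBiInvariant`; Cartier 1979, §I.3–I.4; Bushnell–Henniart 2006, §4.1).
[cite: Cartier1979, §I.3] -/
theorem nonempty_linearEquiv_biInvariant_holds : nonempty_linearEquiv_biInvariant k G K :=
  ⟨heckeAlgebraEquivBiInvariant k G K⟩

end BiInvariantEquiv

end Literature.NumberTheory.Automorphic
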